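import Mathlib
import Summits.Ventures.PercRepro2.ZeroEdges
import Summits.Ventures.PercRepro2.ParallelMerge
import Summits.Ventures.PercRepro2.StarOMain
import Summits.Ventures.PercRepro2.ZeroEdge

/-!
# The star classes with PARALLEL EDGES: any number of edges from `a₃` to each of its marks
(blind cell PercRepro2, night-1 g9; NIGHT1-G9.md §5)

`merge_all`: the extra parallel edges at `a₃` are merged one by one into their representatives
(`ParallelMerge.HMF_merge_iff`), leaving a probability vector that vanishes on them and agrees with
`p` elsewhere; `ZeroEdges.HMF_ext_iff` then deletes them, and on the kept edges the strict star
hypothesis of the class theorem holds.  Hence **`HMF_star_o_multi`** (class O with any number of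
parallel edges from `a₃` to `a₁`, `a₂`, `o`) and `HMF_two_root_multi` (the two-root chain likewise),
with `HCov_*` — the «parallel edges collapse to one coin» clause of the paper statements, in the
kernel (class B: StarMultiB).
-/

namespace Summit.Ventures.PercRepro2

namespace StarMulti

section Merge

variable {V : Type*} {E : Type*} [Fintype E] [DecidableEq E] [Fintype V] [DecidableEq V]
  {R : Type*} [Field R] [LinearOrder R] [IsStrictOrderedRing R]

variable (ends : E → Sym2 V) {f₁ f₂ f₃ : E} (o a₁ a₂ a₃ b : V)

/-- **Merging all the extra parallel edges of a three-coin star**: for a finite set `S` of edges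
disjoint from the coins, each parallel to one of them, there is a probability vector vanishing on
`S`, agreeing with `p` off `S ∪ {f₁, f₂, f₃}`, with the same (HMF) status. -/
theorem merge_all (S : Finset E)
    (hS : ∀ e ∈ S, e ≠ f₁ ∧ e ≠ f₂ ∧ e ≠ f₃ ∧ (ends e = ends f₁ ∨ ends e = ends f₂ ∨ ends e = ends f₃)) :
    ∀ p : E → R, IsProbVec p → ∃ p' : E → R, IsProbVec p' ∧ (∀ e ∈ S, p' e = 0) ∧
      (∀ e, e ∉ S → e ≠ f₁ → e ≠ f₂ → e ≠ f₃ → p' e = p e) ∧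
      (HMF p ends o a₁ a₂ a₃ b ↔ HMF p' ends o a₁ a₂ a₃ b) := by
  classical
  induction S using Finset.induction_on with
  | empty =>
    intro p hp
    exact ⟨p, hp, fun e he => absurd he (Finset.notMem_empty e), fun _ _ _ _ _ => rfl, Iff.rfl⟩
  | insert e S' he ih =>
    intro p hp
    obtain ⟨h1, h2, h3, hpar⟩ := hS e (Finset.mem_insert_self e S')
    have hS' : ∀ e ∈ S', e ≠ f₁ ∧ e ≠ f₂ ∧ e ≠ f₃ ∧
        (ends e = ends f₁ ∨ ends e = ends f₂ ∨ ends e = ends f₃) :=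
      fun e' he' => hS e' (Finset.mem_insert_of_mem he')
    -- the representative of `e` and the merged weights
    obtain ⟨f, hf, hfne, hfpar⟩ : ∃ f, (f = f₁ ∨ f = f₂ ∨ f = f₃) ∧ f ≠ e ∧ ends f = ends e := by
      rcases hpar with h | h | h
      · exact ⟨f₁, Or.inl rfl, h1.symm, h.symm⟩
      · exact ⟨f₂, Or.inr (Or.inl rfl), h2.symm, h.symm⟩
      · exact ⟨f₃, Or.inr (Or.inr rfl), h3.symm, h.symm⟩
    set p₁ := Function.update (Function.update p f (1 - (1 - p f) * (1 - p e))) e 0 with hp₁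
    have hp₁p : IsProbVec p₁ := ParallelMerge.isProbVec_merge p ends hfne hfpar hp
    have hiff : HMF p ends o a₁ a₂ a₃ b ↔ HMF p₁ ends o a₁ a₂ a₃ b :=
      ParallelMerge.HMF_merge_iff p ends hfne hfpar o a₁ a₂ a₃ b
    obtain ⟨p', hp', hz, hagree, hiff'⟩ := ih hS' p₁ hp₁p
    refine ⟨p', hp', ?_, ?_, hiff.trans hiff'⟩
    · intro e' he'
      rcases Finset.mem_insert.1 he' with rfl | he'
      · -- the merged edge keeps its weight `0` through the later merges
        rw [hagree e' he h1 h2 h3, hp₁, Function.update_self]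
      · exact hz e' he'
    · intro e' he' h1' h2' h3'
      have he'' : e' ∉ S' := fun h => he' (Finset.mem_insert_of_mem h)
      have hee : e' ≠ e := fun h => he' (h ▸ Finset.mem_insert_self e S')
      rw [hagree e' he'' h1' h2' h3', hp₁, Function.update_of_ne hee]
      have hef : e' ≠ f := by
        rcases hf with rfl | rfl | rfl
        · exact h1'
        · exact h2'
        · exact h3'
      rw [Function.update_of_ne hef]

end Merge

section Classes

variable {V : Type*} {E : Type*} [Fintype E] [DecidableEq E] [Fintype V] [DecidableEq V]
  {R : Type*} [Field R] [LinearOrder R] [IsStrictOrderedRing R]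

variable (p : E → R) (ends : E → Sym2 V) {f₁ f₂ f₃ : E} {a₃ a₁ a₂ o b : V}

/-- The extra edges of the star at `a₃`: the edges at `a₃` other than the three coins. -/
def extras (ends : E → Sym2 V) (f₁ f₂ f₃ : E) (a₃ : V) : Finset E :=
  Finset.univ.filter fun e => a₃ ∈ ends e ∧ e ≠ f₁ ∧ e ≠ f₂ ∧ e ≠ f₃

omit [Fintype V] in
/-- Membership in the extras. -/
lemma mem_extras {e : E} :
    e ∈ extras ends f₁ f₂ f₃ a₃ ↔ a₃ ∈ ends e ∧ e ≠ f₁ ∧ e ≠ f₂ ∧ e ≠ f₃ := by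
  simp [extras]

/-- **Class O with any number of parallel edges**: (HMF) whenever every edge at `a₃` joins `a₃` to
`a₁`, `a₂` or `o` (one representative edge `f₁, f₂, f₃` of each kind named). -/
theorem HMF_star_o_multi (hp : IsProbVec p) (hf₁ : ends f₁ = s(a₃, a₁)) (hf₂ : ends f₂ = s(a₃, a₂))
    (hf₃ : ends f₃ = s(a₃, o))
    (hstar : ∀ e, a₃ ∈ ends e → ends e = s(a₃, a₁) ∨ ends e = s(a₃, a₂) ∨ ends e = s(a₃, o))
    (h31 : a₃ ≠ a₁) (h32 : a₃ ≠ a₂) (h3o : a₃ ≠ o) (h3b : a₃ ≠ b) (h12 : a₁ ≠ a₂) (h1o : a₁ ≠ o)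
    (h2o : a₂ ≠ o) : HMF p ends o a₁ a₂ a₃ b := by
  classical
  have hS : ∀ e ∈ extras ends f₁ f₂ f₃ a₃, e ≠ f₁ ∧ e ≠ f₂ ∧ e ≠ f₃ ∧
      (ends e = ends f₁ ∨ ends e = ends f₂ ∨ ends e = ends f₃) := by
    intro e he
    obtain ⟨h3, h1, h2, h3'⟩ := (mem_extras ends).1 he
    refine ⟨h1, h2, h3', ?_⟩
    rw [hf₁, hf₂, hf₃]
    exact hstar e h3
  obtain ⟨p', hp', hz, -, hiff⟩ := merge_all ends o a₁ a₂ a₃ b (extras ends f₁ f₂ f₃ a₃) hS p hp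
  rw [hiff]
  -- delete the extras (now of weight `0`)
  have h0 : ∀ e, ¬ (e ∉ extras ends f₁ f₂ f₃ a₃) → p' e = 0 := fun e h => hz e (not_not.1 h)
  rw [ZeroEdges.HMF_ext_iff p' ends h0]
  have hf₁S : f₁ ∉ extras ends f₁ f₂ f₃ a₃ := fun h => ((mem_extras ends).1 h).2.1 rfl
  have hf₂S : f₂ ∉ extras ends f₁ f₂ f₃ a₃ := fun h => ((mem_extras ends).1 h).2.2.1 rfl
  have hf₃S : f₃ ∉ extras ends f₁ f₂ f₃ a₃ := fun h => ((mem_extras ends).1 h).2.2.2 rfl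
  refine StarO.HMF_star_o (ZeroEdges.pR (fun e => e ∉ extras ends f₁ f₂ f₃ a₃) p')
    (ZeroEdges.endsR (fun e => e ∉ extras ends f₁ f₂ f₃ a₃) ends) (ZeroEdges.isProbVec_pR hp')
    (f₁ := ⟨f₁, hf₁S⟩) (f₂ := ⟨f₂, hf₂S⟩) (f₃ := ⟨f₃, hf₃S⟩) hf₁ hf₂ hf₃ ?_ h31 h32 h3o h3b h12 h1o h2o
  rintro ⟨e, he⟩ h3
  have h3' : a₃ ∈ ends e := h3
  by_contra hne
  apply he
  rw [mem_extras]
  refine ⟨h3', ?_, ?_, ?_⟩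
  · intro h; exact hne (Or.inl (Subtype.ext h))
  · intro h; exact hne (Or.inr (Or.inl (Subtype.ext h)))
  · intro h; exact hne (Or.inr (Or.inr (Subtype.ext h)))

/-- (HCOV) for class O with parallel edges. -/
theorem HCov_star_o_multi (hp : IsProbVec p) (hf₁ : ends f₁ = s(a₃, a₁)) (hf₂ : ends f₂ = s(a₃, a₂))
    (hf₃ : ends f₃ = s(a₃, o))
    (hstar : ∀ e, a₃ ∈ ends e → ends e = s(a₃, a₁) ∨ ends e = s(a₃, a₂) ∨ ends e = s(a₃, o))
    (h31 : a₃ ≠ a₁) (h32 : a₃ ≠ a₂) (h3o : a₃ ≠ o) (h3b : a₃ ≠ b) (h12 : a₁ ≠ a₂) (h1o : a₁ ≠ o)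
    (h2o : a₂ ≠ o) : CovForm.HCov p ends o a₁ a₂ a₃ b :=
  HCov_of_HMF p hp ends o a₁ a₂ a₃ b
    (HMF_star_o_multi p ends hp hf₁ hf₂ hf₃ hstar h31 h32 h3o h3b h12 h1o h2o)

/-- **The two-root chain with any number of parallel edges**: (HMF) whenever every edge at `a₃`
joins `a₃` to a root (adjoin an `o`-edge of weight `0` and use class O). -/
theorem HMF_two_root_multi (hp : IsProbVec p) (hf₁ : ends f₁ = s(a₃, a₁)) (hf₂ : ends f₂ = s(a₃, a₂))
    (hstar : ∀ e, a₃ ∈ ends e → ends e = s(a₃, a₁) ∨ ends e = s(a₃, a₂))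
    (h31 : a₃ ≠ a₁) (h32 : a₃ ≠ a₂) (h3o : a₃ ≠ o) (h3b : a₃ ≠ b) (h12 : a₁ ≠ a₂) (h1o : a₁ ≠ o)
    (h2o : a₂ ≠ o) : HMF p ends o a₁ a₂ a₃ b := by
  rw [← ZeroEdge.HMF_ext_iff p ends s(a₃, o)]
  refine HMF_star_o_multi (ZeroEdge.p' p) (ZeroEdge.ends' ends s(a₃, o)) (ZeroEdge.isProbVec_p' hp)
    (f₁ := some f₁) (f₂ := some f₂) (f₃ := none) hf₁ hf₂ rfl ?_ h31 h32 h3o h3b h12 h1o h2o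
  intro e he
  cases e with
  | none => exact Or.inr (Or.inr rfl)
  | some e =>
    rcases hstar e he with h | h
    · exact Or.inl h
    · exact Or.inr (Or.inl h)

/-- (HCOV) for the two-root chain with parallel edges. -/
theorem HCov_two_root_multi (hp : IsProbVec p) (hf₁ : ends f₁ = s(a₃, a₁)) (hf₂ : ends f₂ = s(a₃, a₂))
    (hstar : ∀ e, a₃ ∈ ends e → ends e = s(a₃, a₁) ∨ ends e = s(a₃, a₂))
    (h31 : a₃ ≠ a₁) (h32 : a₃ ≠ a₂) (h3o : a₃ ≠ o) (h3b : a₃ ≠ b) (h12 : a₁ ≠ a₂) (h1o : a₁ ≠ o)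
    (h2o : a₂ ≠ o) : CovForm.HCov p ends o a₁ a₂ a₃ b :=
  HCov_of_HMF p hp ends o a₁ a₂ a₃ b
    (HMF_two_root_multi p ends hp hf₁ hf₂ hstar h31 h32 h3o h3b h12 h1o h2o)

end Classes

end StarMulti

end Summit.Ventures.PercRepro2
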